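import Summits.HubbardSuperconductivity.HubbardSuperconductivity.Theorems.SoloBlindCertificateFromGap
import Summits.HubbardSuperconductivity.HubbardSuperconductivity.Theorems.SoloBlindCertificateForm
import Literature.MathematicalPhysics.QuantumLattice.PairingChannelIdentities
import Literature.MathematicalPhysics.QuantumLattice.TorusPairSusceptibility
import Literature.MathematicalPhysics.QuantumLattice.SectorGroundProjContinuity
import Literature.MathematicalPhysics.QuantumLattice.PairFieldMomentum
import HarnessLib

/-!
# The pair tower: d-wave order in a sector ground state controls the `N ± 2` sectors

Obstruction report, Theorem 11 (part 1 of 2; part 2 `SoloBlindPairTowerBound` supplies the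
`O(L²)` double-commutator bound and the summit-level corollary).

Koma–Tasaki's double-commutator identity (J. Stat. Phys. 76 (1994) 745, proof of Thm. 2.2;
Horsch–von der Linden, Z. Phys. B 72 (1988) 181; in the tree as
`tian_double_commutator_expectation`) is applied to the NON-Hermitian, charge-`2` order operator
`X = Δ†` of the summit, `Δ = pairField g L`. For an eigenvector `Hψ = Eψ`:

  `⟨Δ†ψ, (H-E) Δ†ψ⟩ + ⟨Δψ, (H-E) Δψ⟩ = re ⟨ψ, [Δ, [H, Δ†]] ψ⟩`        (`tower_identity`).

If `ψ` lies in the joint sector `(N, S^z = M)` then `Δ†ψ ∈ (N+2, M)` and `Δψ ∈ (N-2, M)`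
(`pairField_conjTranspose_mulVec_mem_szSector`, `pairField_mulVec_mem_szSector`), so the
variational principle in those sectors gives

  `(E₀(N+2,M) - E) ‖Δ†ψ‖² + (E₀(N-2,M) - E) ‖Δψ‖² ≤ re ⟨ψ, [Δ,[H,Δ†]] ψ⟩`   (`pair_tower_inequality`),

and for a sector GROUND state at `S^z = 0` (`E = E₀(N,0)`), in the language of the tree's
`pairGap` `Δ_pair = ½[E₀(N+2)+E₀(N-2)-2E₀(N)]` and `pairChemicalPotential`
`μ̄ = ¼[E₀(N+2)-E₀(N-2)]` (Lin–Hirsch–Scalapino, PRB 37 (1988) 7359, eq. (9)):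

  `Δ_pair · (‖Δ†ψ‖² + ‖Δψ‖²) ≤ re ⟨ψ,[Δ,[H,Δ†]]ψ⟩ - 2 μ̄ (‖Δ†ψ‖² - ‖Δψ‖²)`   (`pairGap_mul_le`).

Part 2 bounds the right-hand side by `K(t,U,μ̄) L² ‖ψ‖²` (locality of `H` and `Δ`), whence, under
the summit's conclusion `‖Δψ_L‖² ≥ c L⁴`, the PAIR GAP CEILING `Δ_pair(L) = O(1/(c L²))` and the
near-degeneracy of the "tower states" `Δ†ψ_L/‖Δ†ψ_L‖`, `Δψ_L/‖Δψ_L‖` with the ground states of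
the neighbouring even sectors: requirement (R7) of the report — any proof of the summit controls
three adjacent particle-number sectors at the scale `1/(cL²)`, not one.

All statements are elementary (finite-dimensional); tags [folklore] for the identity and the
sector bookkeeping, [this work] for the assembled inequalities.
-/

namespace Summit.HubbardSuperconductivity.HubbardSuperconductivity.Theorems

open Matrix Finset Literature.MathematicalPhysics.QuantumLattice HubbardWave0 GaugeTwist
open Literature.Probability.LatticeModels (Torus.proj TorusSite)
open scoped ComplexConjugate ComplexOrder

namespace PairTower

/-! ### The abstract tower identity and inequality -/

section Abstract

variable {n : Type} [Fintype n] [DecidableEq n]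

/-- **Koma–Tasaki / Horsch–von der Linden identity in an eigenvector, non-Hermitian order
operator.** For Hermitian `H`, `Hψ = Eψ` and any `X`:
`⟨ψ, [Xᴴ,[H,X]] ψ⟩ = (⟨Xψ, H Xψ⟩ - E‖Xψ‖²) + (⟨Xᴴψ, H Xᴴψ⟩ - E‖Xᴴψ‖²)`
(`tian_double_commutator_expectation` for `K = H - E`). Koma–Tasaki, J. Stat. Phys. 76 (1994)
745, proof of Thm. 2.2. [folklore] -/
theorem tower_identity {H : Matrix n n ℂ} (hH : H.IsHermitian) (X : Matrix n n ℂ) {ψ : n → ℂ}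
    {E : ℝ} (hψ : H *ᵥ ψ = (E : ℂ) • ψ) :
    star ψ ⬝ᵥ (Xᴴ * (H * X - X * H) - (H * X - X * H) * Xᴴ) *ᵥ ψ =
      (star (X *ᵥ ψ) ⬝ᵥ H *ᵥ (X *ᵥ ψ) - (E : ℂ) * (star (X *ᵥ ψ) ⬝ᵥ (X *ᵥ ψ))) +
        (star (Xᴴ *ᵥ ψ) ⬝ᵥ H *ᵥ (Xᴴ *ᵥ ψ) - (E : ℂ) * (star (Xᴴ *ᵥ ψ) ⬝ᵥ (Xᴴ *ᵥ ψ))) := by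
  set K : Matrix n n ℂ := H - (E : ℂ) • (1 : Matrix n n ℂ) with hK_def
  have hK : K.IsHermitian := hH.sub (isHermitian_one.smul (Complex.conj_ofReal E))
  have hKψ : K *ᵥ ψ = 0 := by
    rw [hK_def, sub_mulVec, smul_mulVec, one_mulVec, hψ, sub_self]
  have hcomm : H * X - X * H = K * X - X * K := by
    simp only [hK_def, sub_mul, mul_sub, Matrix.smul_mul, Matrix.mul_smul, Matrix.one_mul,
      Matrix.mul_one]
    abel
  have hKform : ∀ φ : n → ℂ,
      star φ ⬝ᵥ K *ᵥ φ = star φ ⬝ᵥ H *ᵥ φ - (E : ℂ) * (star φ ⬝ᵥ φ) := by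
    intro φ
    rw [hK_def, sub_mulVec, smul_mulVec, one_mulVec, dotProduct_sub, dotProduct_smul,
      smul_eq_mul]
  rw [hcomm, tian_double_commutator_expectation hK hKψ, hKform, hKform]

/-- **The tower inequality.** If moreover `Xψ ∈ K₁` and `Xᴴψ ∈ K₂` for subspaces `K₁, K₂` with
sector energies `e₁ = minEnergyOn H K₁`, `e₂ = minEnergyOn H K₂`, then
`(e₁ - E)‖Xψ‖² + (e₂ - E)‖Xᴴψ‖² ≤ re ⟨ψ, [Xᴴ,[H,X]] ψ⟩` (variational principle in `K₁`, `K₂`).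
Koma–Tasaki (1994) Thm. 2.2; Horsch–von der Linden (1988). [folklore] -/
theorem tower_inequality {H : Matrix n n ℂ} (hH : H.IsHermitian) (X : Matrix n n ℂ) {ψ : n → ℂ}
    {E : ℝ} (hψ : H *ᵥ ψ = (E : ℂ) • ψ) (K₁ K₂ : Submodule ℂ (n → ℂ)) (h₁ : X *ᵥ ψ ∈ K₁)
    (h₂ : Xᴴ *ᵥ ψ ∈ K₂) :
    (H.minEnergyOn K₁ - E) * (star (X *ᵥ ψ) ⬝ᵥ (X *ᵥ ψ)).re +
        (H.minEnergyOn K₂ - E) * (star (Xᴴ *ᵥ ψ) ⬝ᵥ (Xᴴ *ᵥ ψ)).re ≤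
      (star ψ ⬝ᵥ (Xᴴ * (H * X - X * H) - (H * X - X * H) * Xᴴ) *ᵥ ψ).re := by
  have hid := congrArg Complex.re (tower_identity hH X hψ)
  have hv₁ := minEnergyOn_mul_le_re_rayleigh hH K₁ h₁
  have hv₂ := minEnergyOn_mul_le_re_rayleigh hH K₂ h₂
  rw [hid, Complex.add_re, Complex.sub_re, Complex.sub_re, Complex.re_ofReal_mul,
    Complex.re_ofReal_mul]
  linarith

end Abstract

/-! ### Sector bookkeeping for the pair field on the Hubbard torus -/

section Sector

-- see `SoloBlindTwistAveraging`: synthesised vs landed `DecidableEq` instances on `Lex`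
attribute [-instance] instDecidableEqLex

variable {L : ℕ} [NeZero L]

omit [NeZero L] in
/-- An opposite-spin pair annihilator `c_{Yτ} c_{Xσ}` (`σ ≠ τ`) maps the joint sector `(N, S^z = M)`
into `(N-2, S^z = M)`. Lieb, PRL 62 (1989) 1201 (sectors); Bratteli–Robinson II §5.2.2. [folklore] -/
theorem annihilation_mul_annihilation_mulVec_mem_szSector {σ τ : Fin 2} (hστ : σ ≠ τ)
    (X Y : FermionTorus 2 L) {N : ℕ} {M : ℝ} {ψ : Fock (Orb (FermionTorus 2 L))}
    (hψ : ψ ∈ szSector N M) :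
    (annihilation (orb Y τ) * annihilation (orb X σ)) *ᵥ ψ ∈ szSector (N - 2) M := by
  rw [mem_szSector_iff] at hψ ⊢
  refine ⟨?_, ?_⟩
  · rw [← mulVec_mulVec]
    have h1 := PosSemidefTrace.isNParticle_annihilation_mulVec hψ.1 (orb X σ)
    have h2 := PosSemidefTrace.isNParticle_annihilation_mulVec h1 (orb Y τ)
    rwa [Nat.sub_sub] at h2
  · have hc : (spinZ : Matrix _ _ ℂ) * (annihilation (orb Y τ) * annihilation (orb X σ)) =
        annihilation (orb Y τ) * annihilation (orb X σ) * spinZ := by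
      have h := congrArg conjTranspose (spinZ_commute_creation_mul_creation hστ X Y).eq
      simp only [conjTranspose_mul, creation_conjTranspose, spinZ_isHermitian.eq] at h
      exact h.symm
    rw [mulVec_mulVec, hc, ← mulVec_mulVec, hψ.2, mulVec_smul]

omit [NeZero L] in
/-- An opposite-spin pair creator `(c_{Yτ} c_{Xσ})ᴴ = c†_{Xσ} c†_{Yτ}` (`σ ≠ τ`) maps `(N, M)` into
`(N+2, M)`. Lieb, PRL 62 (1989) 1201; Bratteli–Robinson II §5.2.2. [folklore] -/
theorem creation_mul_creation_mulVec_mem_szSector {σ τ : Fin 2} (hστ : σ ≠ τ)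
    (X Y : FermionTorus 2 L) {N : ℕ} {M : ℝ} {ψ : Fock (Orb (FermionTorus 2 L))}
    (hψ : ψ ∈ szSector N M) :
    (creation (orb X σ) * creation (orb Y τ)) *ᵥ ψ ∈ szSector (N + 2) M := by
  rw [mem_szSector_iff] at hψ ⊢
  refine ⟨?_, ?_⟩
  · rw [← mulVec_mulVec]
    exact IsNParticle.creation_mulVec_holds (IsNParticle.creation_mulVec_holds hψ.1 _) _
  · rw [mulVec_mulVec, (spinZ_commute_creation_mul_creation hστ X Y).eq, ← mulVec_mulVec, hψ.2,
      mulVec_smul]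

/-- `P(x,e) = c_{x↑}c_{x+e,↓} - c_{x↓}c_{x+e,↑}` maps `(N, M)` into `(N-2, M)`. [folklore] -/
theorem pairTerm_mulVec_mem_szSector (x : TorusSite 2 L) (e : Fin 2 → ℤ) {N : ℕ} {M : ℝ}
    {ψ : Fock (Orb (FermionTorus 2 L))} (hψ : ψ ∈ szSector N M) :
    pairTerm x e *ᵥ ψ ∈ szSector (N - 2) M := by
  unfold pairTerm
  rw [sub_mulVec]
  refine Submodule.sub_mem _ ?_ ?_
  · exact annihilation_mul_annihilation_mulVec_mem_szSector (σ := 1) (τ := 0) (by decide) _ _ hψ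
  · exact annihilation_mul_annihilation_mulVec_mem_szSector (σ := 0) (τ := 1) (by decide) _ _ hψ

/-- `P(x,e)ᴴ` maps `(N, M)` into `(N+2, M)`. [folklore] -/
theorem pairTerm_conjTranspose_mulVec_mem_szSector (x : TorusSite 2 L) (e : Fin 2 → ℤ) {N : ℕ} {M : ℝ}
    {ψ : Fock (Orb (FermionTorus 2 L))} (hψ : ψ ∈ szSector N M) :
    (pairTerm x e)ᴴ *ᵥ ψ ∈ szSector (N + 2) M := by
  unfold pairTerm
  rw [conjTranspose_sub, conjTranspose_mul, conjTranspose_mul, annihilation_conjTranspose,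
    annihilation_conjTranspose, annihilation_conjTranspose, annihilation_conjTranspose, sub_mulVec]
  refine Submodule.sub_mem _ ?_ ?_
  · exact creation_mul_creation_mulVec_mem_szSector (σ := 1) (τ := 0) (by decide) _ _ hψ
  · exact creation_mul_creation_mulVec_mem_szSector (σ := 0) (τ := 1) (by decide) _ _ hψ

/-- **The pair field lowers the particle number by two at fixed `S^z`**: `Δ_g ψ ∈ (N-2, M)` for
`ψ ∈ (N, M)`. Scalapino, Phys. Rep. 250 (1995) 329, §2. [folklore] -/
theorem pairField_mulVec_mem_szSector (g : (Fin 2 → ℤ) → ℝ) {N : ℕ} {M : ℝ}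
    {ψ : Fock (Orb (FermionTorus 2 L))} (hψ : ψ ∈ szSector N M) :
    pairField g L *ᵥ ψ ∈ szSector (N - 2) M := by
  rw [pairField, sum_mulVec]
  refine Submodule.sum_mem _ fun x _ => ?_
  rw [localPair_eq_sum_pairTerm, sum_mulVec]
  refine Submodule.sum_mem _ fun e _ => ?_
  rw [smul_mulVec]
  exact Submodule.smul_mem _ _ (pairTerm_mulVec_mem_szSector x e hψ)

/-- **The adjoint pair field raises the particle number by two at fixed `S^z`**:
`Δ_gᴴ ψ ∈ (N+2, M)` for `ψ ∈ (N, M)`. Scalapino, Phys. Rep. 250 (1995) 329, §2. [folklore] -/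
theorem pairField_conjTranspose_mulVec_mem_szSector (g : (Fin 2 → ℤ) → ℝ) {N : ℕ} {M : ℝ}
    {ψ : Fock (Orb (FermionTorus 2 L))} (hψ : ψ ∈ szSector N M) :
    (pairField g L)ᴴ *ᵥ ψ ∈ szSector (N + 2) M := by
  rw [pairField, conjTranspose_sum, sum_mulVec]
  refine Submodule.sum_mem _ fun x _ => ?_
  rw [localPair_eq_sum_pairTerm, conjTranspose_sum, sum_mulVec]
  refine Submodule.sum_mem _ fun e _ => ?_
  rw [conjTranspose_smul, smul_mulVec]
  exact Submodule.smul_mem _ _ (pairTerm_conjTranspose_mulVec_mem_szSector x e hψ)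

end Sector

/-! ### The pair tower of the Hubbard torus -/

section Hubbard

attribute [-instance] instDecidableEqLex

variable {L : ℕ} [NeZero L]

/-- **Pair-tower inequality for the Hubbard torus** (any hopping `t`, coupling `U`, form factor
`g`, sector `(N, S^z = M)`). If `ψ ∈ (N, M)` is an eigenvector `Hψ = Eψ` of `H = hubbardTorus 2 L t U`
and `Δ = pairField g L`, then
`(E₀(N+2,M) - E) ‖Δᴴψ‖² + (E₀(N-2,M) - E) ‖Δψ‖² ≤ re ⟨ψ, [Δ,[H,Δᴴ]] ψ⟩`,
`E₀(·,M) = minEnergyOn H (szSector · M)`. Koma–Tasaki (1994) Thm. 2.2, pair channel. [this work] -/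
theorem pair_tower_inequality (t U : ℝ) (g : (Fin 2 → ℤ) → ℝ) {N : ℕ} {M E : ℝ}
    {ψ : Fock (Orb (FermionTorus 2 L))} (hψ : ψ ∈ szSector N M)
    (hE : hubbardTorus 2 L t U *ᵥ ψ = (E : ℂ) • ψ) :
    ((hubbardTorus 2 L t U).minEnergyOn (szSector (N + 2) M) - E) *
          (star ((pairField g L)ᴴ *ᵥ ψ) ⬝ᵥ ((pairField g L)ᴴ *ᵥ ψ)).re +
        ((hubbardTorus 2 L t U).minEnergyOn (szSector (N - 2) M) - E) *
          (star (pairField g L *ᵥ ψ) ⬝ᵥ (pairField g L *ᵥ ψ)).re ≤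
      (star ψ ⬝ᵥ (pairField g L * (hubbardTorus 2 L t U * (pairField g L)ᴴ -
          (pairField g L)ᴴ * hubbardTorus 2 L t U) -
        (hubbardTorus 2 L t U * (pairField g L)ᴴ - (pairField g L)ᴴ * hubbardTorus 2 L t U) *
          pairField g L) *ᵥ ψ).re := by
  have h := tower_inequality (isHermitian_hubbardTorus L t U) (pairField g L)ᴴ hE
    (szSector (N + 2) M) (szSector (N - 2) M) (pairField_conjTranspose_mulVec_mem_szSector g hψ)
    (by rw [conjTranspose_conjTranspose]; exact pairField_mulVec_mem_szSector g hψ)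
  simpa only [conjTranspose_conjTranspose] using h

/-- **The pair gap and the pair tower.** For a ground state `ψ` of `H = hubbardTorus 2 L t U` in the
sector `(N, S^z = 0)`, with the tree's `pairGap H N = ½[E₀(N+2)+E₀(N-2)-2E₀(N)]` and
`pairChemicalPotential H N = ¼[E₀(N+2)-E₀(N-2)]` (`S^z = 0` sector energies) and
`Δ = pairField g L`:
`pairGap · (‖Δᴴψ‖² + ‖Δψ‖²) ≤ re ⟨ψ,[Δ,[H,Δᴴ]]ψ⟩ - 2 μ̄ (‖Δᴴψ‖² - ‖Δψ‖²)`.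
(For `N < 2` the tree's truncated conventions make both sides refer to `E₀(0)`; the inequality
holds as stated for every `N`.) Lin–Hirsch–Scalapino, PRB 37 (1988) 7359, eq. (9);
Koma–Tasaki (1994) Thm. 2.2. [this work] -/
theorem pairGap_mul_le (t U : ℝ) (g : (Fin 2 → ℤ) → ℝ) {N : ℕ}
    {ψ : Fock (Orb (FermionTorus 2 L))} (hψ : IsGroundStateInSector (hubbardTorus 2 L t U) N 0 ψ) :
    pairGap (hubbardTorus 2 L t U) N *
        ((star ((pairField g L)ᴴ *ᵥ ψ) ⬝ᵥ ((pairField g L)ᴴ *ᵥ ψ)).re +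
          (star (pairField g L *ᵥ ψ) ⬝ᵥ (pairField g L *ᵥ ψ)).re) ≤
      (star ψ ⬝ᵥ (pairField g L * (hubbardTorus 2 L t U * (pairField g L)ᴴ -
          (pairField g L)ᴴ * hubbardTorus 2 L t U) -
        (hubbardTorus 2 L t U * (pairField g L)ᴴ - (pairField g L)ᴴ * hubbardTorus 2 L t U) *
          pairField g L) *ᵥ ψ).re -
        2 * pairChemicalPotential (hubbardTorus 2 L t U) N *
          ((star ((pairField g L)ᴴ *ᵥ ψ) ⬝ᵥ ((pairField g L)ᴴ *ᵥ ψ)).re -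
            (star (pairField g L *ᵥ ψ) ⬝ᵥ (pairField g L *ᵥ ψ)).re) := by
  have h := pair_tower_inequality t U g hψ.1 hψ.2.2
  have hp := minEnergyOn_add_two_sub_eq_pairGap (hubbardTorus 2 L t U) N
  have hm := minEnergyOn_sub_two_sub_eq_pairGap (hubbardTorus 2 L t U) N
  -- `e₊ - E₀ = Δ + 2μ̄`, `e₋ - E₀ = Δ - 2μ̄`
  have ep : (hubbardTorus 2 L t U).minEnergyOn (szSector (N + 2) 0) -
      (hubbardTorus 2 L t U).minEnergyOn (szSector N 0) =
      pairGap (hubbardTorus 2 L t U) N + 2 * pairChemicalPotential (hubbardTorus 2 L t U) N := by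
    linarith
  have em : (hubbardTorus 2 L t U).minEnergyOn (szSector (N - 2) 0) -
      (hubbardTorus 2 L t U).minEnergyOn (szSector N 0) =
      pairGap (hubbardTorus 2 L t U) N - 2 * pairChemicalPotential (hubbardTorus 2 L t U) N := by
    linarith
  rw [ep, em] at h
  linarith

/-- **Energy of the raised tower state.** Same setting; if the pair gap is nonnegative then the
`(N+2)`-particle tower state `Δᴴψ` has energy at most `E₀(N) + 2μ̄ + D/‖Δᴴψ‖²` per unit norm, i.e.
`⟨Δᴴψ, H Δᴴψ⟩ - (E₀(N) + 2μ̄) ‖Δᴴψ‖² ≤ re⟨ψ,[Δ,[H,Δᴴ]]ψ⟩ - (Δ_pair - 2μ̄)‖Δψ‖²`, and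
symmetrically for `Δψ`; here stated as the exact splitting
`(⟨Δᴴψ,HΔᴴψ⟩ - E₀‖Δᴴψ‖²) + (⟨Δψ,HΔψ⟩ - E₀‖Δψ‖²) = re⟨ψ,[Δ,[H,Δᴴ]]ψ⟩` with both brackets
nonnegative up to the sector floors (Horsch–von der Linden's "low-lying states", pair channel).
Koma–Tasaki (1994) Thm. 2.2 (2.9). [this work] -/
theorem tower_states_energy_splitting (t U : ℝ) (g : (Fin 2 → ℤ) → ℝ) {N : ℕ} {M E : ℝ}
    {ψ : Fock (Orb (FermionTorus 2 L))} (hψ : ψ ∈ szSector N M)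
    (hE : hubbardTorus 2 L t U *ᵥ ψ = (E : ℂ) • ψ) :
    ((star ((pairField g L)ᴴ *ᵥ ψ) ⬝ᵥ hubbardTorus 2 L t U *ᵥ ((pairField g L)ᴴ *ᵥ ψ)).re -
          E * (star ((pairField g L)ᴴ *ᵥ ψ) ⬝ᵥ ((pairField g L)ᴴ *ᵥ ψ)).re) +
        ((star (pairField g L *ᵥ ψ) ⬝ᵥ hubbardTorus 2 L t U *ᵥ (pairField g L *ᵥ ψ)).re -
          E * (star (pairField g L *ᵥ ψ) ⬝ᵥ (pairField g L *ᵥ ψ)).re) =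
      (star ψ ⬝ᵥ (pairField g L * (hubbardTorus 2 L t U * (pairField g L)ᴴ -
          (pairField g L)ᴴ * hubbardTorus 2 L t U) -
        (hubbardTorus 2 L t U * (pairField g L)ᴴ - (pairField g L)ᴴ * hubbardTorus 2 L t U) *
          pairField g L) *ᵥ ψ).re ∧
      ((hubbardTorus 2 L t U).minEnergyOn (szSector (N + 2) M) - E) *
          (star ((pairField g L)ᴴ *ᵥ ψ) ⬝ᵥ ((pairField g L)ᴴ *ᵥ ψ)).re ≤
        (star ((pairField g L)ᴴ *ᵥ ψ) ⬝ᵥ hubbardTorus 2 L t U *ᵥ ((pairField g L)ᴴ *ᵥ ψ)).re -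
          E * (star ((pairField g L)ᴴ *ᵥ ψ) ⬝ᵥ ((pairField g L)ᴴ *ᵥ ψ)).re ∧
      ((hubbardTorus 2 L t U).minEnergyOn (szSector (N - 2) M) - E) *
          (star (pairField g L *ᵥ ψ) ⬝ᵥ (pairField g L *ᵥ ψ)).re ≤
        (star (pairField g L *ᵥ ψ) ⬝ᵥ hubbardTorus 2 L t U *ᵥ (pairField g L *ᵥ ψ)).re -
          E * (star (pairField g L *ᵥ ψ) ⬝ᵥ (pairField g L *ᵥ ψ)).re := by
  have hid := congrArg Complex.re
    (tower_identity (isHermitian_hubbardTorus L t U) (pairField g L)ᴴ hE)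
  simp only [conjTranspose_conjTranspose, Complex.add_re, Complex.sub_re,
    Complex.re_ofReal_mul] at hid
  have hv₁ := minEnergyOn_mul_le_re_rayleigh (isHermitian_hubbardTorus L t U) (szSector (N + 2) M)
    (pairField_conjTranspose_mulVec_mem_szSector g hψ)
  have hv₂ := minEnergyOn_mul_le_re_rayleigh (isHermitian_hubbardTorus L t U) (szSector (N - 2) M)
    (pairField_mulVec_mem_szSector g hψ)
  refine ⟨hid.symm, ?_, ?_⟩ <;> linarith

end Hubbard

end PairTower

end Summit.HubbardSuperconductivity.HubbardSuperconductivity.Theorems
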